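import Summits.Ventures.PercRepro.Night2SeriesClassesThreeOneCellsE
import Summits.Ventures.PercRepro.Night2SeriesClassesCellsB

/-!
# PercRepro — **THE `(7, 5)` SHADOW ROW MODULO THE RESIDUES R** (night-2, gen 23)

`shadowHall_seven_five_of_residuesR`: the residues Q (the cell `(3, 0)` closed) with, at `(3, 1)`, the series-class
clauses «at most three fat thin closures», «`|G| = 11` → at most two, pairwise disjoint» (`NoMeetingFat`),
«`12 ≤ |G| ≤ 15` → three closures form a triangle» (`TriangleFat`), «`|G| ≥ 16` → at most one fat thin closure».
-/

namespace PercRepro.Shadow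

open Finset PerFlat ThmH

section SevenFiveR

variable {α' : Type} [DecidableEq α']

/-- **THE `(7, 5)` SHADOW ROW FOR EVERY FINITE MATROID MODULO THE RESIDUES R**. -/
theorem shadowHall_seven_five_of_residuesR
    (h20 : ∀ (N : Matroid α') [N.Finite] (G : Finset α'), CellHyp N G →
      (gr N \ G).card = 2 → kColoops N G = 0 → FatMember N G 6 3 →
      (FatBasis N G 6 2 ∨ FatMember N G 6 2) → LocalShadowHall N 5 G)
    (h21 : ∀ (N : Matroid α') [N.Finite] (G : Finset α'), CellHyp N G →
      (gr N \ G).card = 2 → kColoops N G = 1 → FatMember N G 5 4 →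
      (FatBasis N G 5 3 ∨ FatMember N G 5 3) → LocalShadowHall N 5 G)
    (h31 : ∀ (N : Matroid α') [N.Finite] (G : Finset α'), CellHyp N G →
      (gr N \ G).card = 3 → kColoops N G = 1 → 11 ≤ G.card → G.card ≤ 17 → FatMember N G 5 2 →
      (G.card = 17 → FatBasis N G 5 2) → (G.card = 17 → NestedFat N G 2 3) →
      (G.card = 16 → MeetingFat N G 2) → (11 ≤ G.card ∧ G.card ≤ 17 → NoThreeDisjointFat N G 2) →
      (G.card = 11 ∨ G.card = 15 ∨ G.card = 16 → FatBasis N G 5 3) →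
      (12 ≤ G.card ∧ G.card ≤ 14 → FatBasis N G 5 4) →
      (fatClosures N 5 G 2).card ≤ 3 → (G.card = 11 → (fatClosures N 5 G 2).card ≤ 2 ∧ NoMeetingFat N G 2) →
      (12 ≤ G.card ∧ G.card ≤ 15 → TriangleFat N G 2) → (16 ≤ G.card → (fatClosures N 5 G 2).card ≤ 1) →
      LocalShadowHall N 5 G)
    (h32 : ∀ (N : Matroid α') [N.Finite] (G : Finset α'), CellHyp N G →
      (gr N \ G).card = 3 → kColoops N G = 2 → FatMember N G 4 2 → LocalShadowHall N 5 G)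
    (M : Matroid α') [M.Finite] : ShadowHall M 7 5 (phiK 7 5) := by
  apply shadowHall_seven_five_of_residuesQ h20 h21 _ h32
  intro N _ G hcell hd hk h11 h17 hfm c17a c17b c16 cnd3 cb3 cb4
  by_cases hcl : (fatClosures N 5 G 2).card ≤ 3 ∧ (G.card = 11 → (fatClosures N 5 G 2).card ≤ 2 ∧ NoMeetingFat N G 2) ∧
      (12 ≤ G.card ∧ G.card ≤ 15 → TriangleFat N G 2) ∧ (16 ≤ G.card → (fatClosures N 5 G 2).card ≤ 1)
  · exact h31 N G hcell hd hk h11 h17 hfm c17a c17b c16 cnd3 cb3 cb4 hcl.1 hcl.2.1 hcl.2.2.1 hcl.2.2.2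
  · have hnot := hcl
    rcases (show G.card = 11 ∨ G.card = 12 ∨ G.card = 13 ∨ G.card = 14 ∨ G.card = 15 ∨ G.card = 16 ∨ G.card = 17
      by omega) with hN | hN | hN | hN | hN | hN | hN
    · exact localShadowHall_three_one_of_not_clauses hcell.2.2.2 hd
        (fun hpx hpy hpz hxy hxz hyz hK hcoc =>
        localShadowHall_three_one_five_eleven_of_K4 hcell.2.2.2 hd hk hcell.1 hcell.2.1 hN hpx hpy hpz hxy hxz hyz hK hcoc)
        (fun hpx hpy hxy huv hdj hK hH₀ hH₁ hH₂ hH₃ =>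
        localShadowHall_three_one_five_eleven_of_trianglePair hcell.2.2.2 hd hk hcell.1 hcell.2.1 hN hpx hpy hxy huv hdj hK hH₀ hH₁ hH₂ hH₃)
        (fun hB₀ hB₁ hB₂ hf₀ hf₁ hf₂ h01 h02 h12 =>
        localShadowHall_three_one_five_eleven_of_threeDisjoint hcell.2.2.2 hd hk hcell.1 hcell.2.1 hN hB₀ hB₁ hB₂ hf₀ hf₁ hf₂ h01 h02 h12)
        (fun _ {p x y} hpx hpy hxy hK hH₀ hH₁ hH₂ =>
        localShadowHall_three_one_five_eleven_of_triangle hcell.2.2.2 hd hk hcell.1 hcell.2.1 hN (p := p) (x := x) (y := y) hpx hpy hxy hK hH₀ hH₁ hH₂)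
        (fun h => absurd h (by omega))
        (by omega) hnot
    · exact localShadowHall_three_one_of_not_clauses hcell.2.2.2 hd
        (fun hpx hpy hpz hxy hxz hyz hK hcoc =>
        localShadowHall_three_one_five_twelve_of_K4 hcell.2.2.2 hd hk hcell.1 hcell.2.1 hN hpx hpy hpz hxy hxz hyz hK hcoc)
        (fun hpx hpy hxy huv hdj hK hH₀ hH₁ hH₂ hH₃ =>
        localShadowHall_three_one_five_twelve_of_trianglePair hcell.2.2.2 hd hk hcell.1 hcell.2.1 hN hpx hpy hxy huv hdj hK hH₀ hH₁ hH₂ hH₃)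
        (fun hB₀ hB₁ hB₂ hf₀ hf₁ hf₂ h01 h02 h12 =>
        localShadowHall_three_one_five_twelve_of_threeDisjoint hcell.2.2.2 hd hk hcell.1 hcell.2.1 hN hB₀ hB₁ hB₂ hf₀ hf₁ hf₂ h01 h02 h12)
        (fun h => absurd h (by omega))
        (fun h => absurd h (by omega))
        (by omega) hnot
    · exact localShadowHall_three_one_of_not_clauses hcell.2.2.2 hd
        (fun hpx hpy hpz hxy hxz hyz hK hcoc =>
        localShadowHall_three_one_five_thirteen_of_K4 hcell.2.2.2 hd hk hcell.1 hcell.2.1 hN hpx hpy hpz hxy hxz hyz hK hcoc)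
        (fun hpx hpy hxy huv hdj hK hH₀ hH₁ hH₂ hH₃ =>
        localShadowHall_three_one_five_thirteen_of_trianglePair hcell.2.2.2 hd hk hcell.1 hcell.2.1 hN hpx hpy hxy huv hdj hK hH₀ hH₁ hH₂ hH₃)
        (fun hB₀ hB₁ hB₂ hf₀ hf₁ hf₂ h01 h02 h12 =>
        localShadowHall_three_one_five_thirteen_of_threeDisjoint hcell.2.2.2 hd hk hcell.1 hcell.2.1 hN hB₀ hB₁ hB₂ hf₀ hf₁ hf₂ h01 h02 h12)
        (fun h => absurd h (by omega))
        (fun h => absurd h (by omega))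
        (by omega) hnot
    · exact localShadowHall_three_one_of_not_clauses hcell.2.2.2 hd
        (fun hpx hpy hpz hxy hxz hyz hK hcoc =>
        localShadowHall_three_one_five_fourteen_of_K4 hcell.2.2.2 hd hk hcell.1 hcell.2.1 hN hpx hpy hpz hxy hxz hyz hK hcoc)
        (fun hpx hpy hxy huv hdj hK hH₀ hH₁ hH₂ hH₃ =>
        localShadowHall_three_one_five_fourteen_of_trianglePair hcell.2.2.2 hd hk hcell.1 hcell.2.1 hN hpx hpy hxy huv hdj hK hH₀ hH₁ hH₂ hH₃)
        (fun hB₀ hB₁ hB₂ hf₀ hf₁ hf₂ h01 h02 h12 =>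
        localShadowHall_three_one_five_fourteen_of_threeDisjoint hcell.2.2.2 hd hk hcell.1 hcell.2.1 hN hB₀ hB₁ hB₂ hf₀ hf₁ hf₂ h01 h02 h12)
        (fun h => absurd h (by omega))
        (fun h => absurd h (by omega))
        (by omega) hnot
    · exact localShadowHall_three_one_of_not_clauses hcell.2.2.2 hd
        (fun hpx hpy hpz hxy hxz hyz hK hcoc =>
        localShadowHall_three_one_five_fifteen_of_K4 hcell.2.2.2 hd hk hcell.1 hcell.2.1 hN hpx hpy hpz hxy hxz hyz hK hcoc)
        (fun hpx hpy hxy huv hdj hK hH₀ hH₁ hH₂ hH₃ =>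
        localShadowHall_three_one_five_fifteen_of_trianglePair hcell.2.2.2 hd hk hcell.1 hcell.2.1 hN hpx hpy hxy huv hdj hK hH₀ hH₁ hH₂ hH₃)
        (fun hB₀ hB₁ hB₂ hf₀ hf₁ hf₂ h01 h02 h12 =>
        localShadowHall_three_one_five_fifteen_of_threeDisjoint hcell.2.2.2 hd hk hcell.1 hcell.2.1 hN hB₀ hB₁ hB₂ hf₀ hf₁ hf₂ h01 h02 h12)
        (fun h => absurd h (by omega))
        (fun h => absurd h (by omega))
        (by omega) hnot
    · exact localShadowHall_three_one_of_not_clauses hcell.2.2.2 hd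
        (fun hpx hpy hpz hxy hxz hyz hK hcoc =>
        localShadowHall_three_one_five_sixteen_of_K4 hcell.2.2.2 hd hk hcell.1 hcell.2.1 hN hpx hpy hpz hxy hxz hyz hK hcoc)
        (fun hpx hpy hxy huv hdj hK hH₀ hH₁ hH₂ hH₃ =>
        localShadowHall_three_one_five_sixteen_of_trianglePair hcell.2.2.2 hd hk hcell.1 hcell.2.1 hN hpx hpy hxy huv hdj hK hH₀ hH₁ hH₂ hH₃)
        (fun hB₀ hB₁ hB₂ hf₀ hf₁ hf₂ h01 h02 h12 =>
        localShadowHall_three_one_five_sixteen_of_threeDisjoint hcell.2.2.2 hd hk hcell.1 hcell.2.1 hN hB₀ hB₁ hB₂ hf₀ hf₁ hf₂ h01 h02 h12)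
        (fun _ {p x y} hpx hpy hxy hK hH₀ hH₁ hH₂ =>
        localShadowHall_three_one_five_sixteen_of_triangle hcell.2.2.2 hd hk hcell.1 hcell.2.1 hN (p := p) (x := x) (y := y) hpx hpy hxy hK hH₀ hH₁ hH₂)
        (fun _ {p x u v} hpx huv hdj hK hH₀ hH₃ =>
        localShadowHall_three_one_five_sixteen_of_twoPairs hcell.2.2.2 hd hk hcell.1 hcell.2.1 hN (p := p) (x := x) (u := u) (v := v) hpx huv hdj hK hH₀ hH₃)
        (by omega) hnot
    · exact localShadowHall_three_one_of_not_clauses hcell.2.2.2 hd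
        (fun hpx hpy hpz hxy hxz hyz hK hcoc =>
        localShadowHall_three_one_five_seventeen_of_K4 hcell.2.2.2 hd hk hcell.1 hcell.2.1 hN hpx hpy hpz hxy hxz hyz hK hcoc)
        (fun hpx hpy hxy huv hdj hK hH₀ hH₁ hH₂ hH₃ =>
        localShadowHall_three_one_five_seventeen_of_trianglePair hcell.2.2.2 hd hk hcell.1 hcell.2.1 hN hpx hpy hxy huv hdj hK hH₀ hH₁ hH₂ hH₃)
        (fun hB₀ hB₁ hB₂ hf₀ hf₁ hf₂ h01 h02 h12 =>
        localShadowHall_three_one_five_seventeen_of_threeDisjoint hcell.2.2.2 hd hk hcell.1 hcell.2.1 hN hB₀ hB₁ hB₂ hf₀ hf₁ hf₂ h01 h02 h12)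
        (fun _ {p x y} hpx hpy hxy hK hH₀ hH₁ hH₂ =>
        localShadowHall_three_one_five_seventeen_of_triangle hcell.2.2.2 hd hk hcell.1 hcell.2.1 hN (p := p) (x := x) (y := y) hpx hpy hxy hK hH₀ hH₁ hH₂)
        (fun _ {p x u v} hpx huv hdj hK hH₀ hH₃ =>
        localShadowHall_three_one_five_seventeen_of_twoPairs hcell.2.2.2 hd hk hcell.1 hcell.2.1 hN (p := p) (x := x) (u := u) (v := v) hpx huv hdj hK hH₀ hH₃)
        (by omega) hnot

end SevenFiveR

end PercRepro.Shadow
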